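import Summits.FinalStateConjecture.FinalStateConjecture.Theorems.CaptureSuffices.Negative.NakedMemberThresholds
import Literature.Geometry.Lorentzian.CauchyProblemMGHDExistence
import Literature.Geometry.Lorentzian.LeviCivitaProofs

/-!
# `CaptureSuffices` (crux `stmt-FinalStateConjecture-9953`, route `PhaseMixingCapture`):
# naked and exposed-edge members of the capture basins — the kinematic ceiling `γ ≥ 1`

Negative-side support file of the crux disprover (cdisprove seat, cycle 2), part 2 of 2 (part 1:
`NakedMemberThresholds.lean`, the elementary thresholds and the exponent bookkeeping). No
definitions, no named facts, `sorry`-free; the two structural theorems carry their print-true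
hypotheses explicitly (see "Hypotheses" below).

## The observation

Both capture hypotheses of the crux (`NearExtremalKappaCapture`, item 10606, and
`BulkKerrCapture`, item 10696) quantify over ALL smooth solutions `D` of the vacuum constraints
on the truncated Kerr–Schild slice `Kerr.slice a M = {t* = 0, r > M}` lying in a weighted-Sobolev
ball around the reference datum `Kerr.data M a M`, and conclude, for every maximal vacuum Cauchy
development of `D`, far-origin sojourn-completeness of `𝓘⁺`, `Cᵏ` convergence of a region to a
SUB-extremal Kerr exterior, and a parameter modulus. Among the admissible `D` sits the
one-parameter **mass family at fixed spin** `M' ↦ Kerr.data M' a M` (`0 ≤ M'`; the slice depends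
on `a` only): every member is a smooth vacuum datum on the truncated slice — the ring `{r = 0}`
is cut away — including the **overspinning** members `M' < |a|` (Kerr–Schild data of a naked
ring singularity, no horizon at all) and the **exposed-edge** sub-extremal members
`|a| ≤ M' < (M² + a²)/(2M)`, whose outer horizon `r₊(M', a) = M' + √(M'² − a²)` lies strictly
BELOW the truncation radius `r₀ = M` (`rPlus_lt_iff`), so that the slice misses the black hole
altogether. For both kinds the inner edge `{t* = 0, r = M}` of the data is visible from infinity:
the maximal development is the domain of dependence of the truncated slice inside the Kerr–Schild
spacetime `(M', a)`, its future boundary is the outgoing null hypersurface emanating from the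
edge 2-sphere (Hawking–Ellis Prop. 6.5.3), which reaches arbitrarily large radii at bounded
retarded time, and every ingoing null ray from a far origin leaves the development after an
affine sojourn in `J⁺(B₀)` bounded independently of the origin — exactly the
"naked-singularity MGHD posed on a pre-singular slice ✗" row of the test table for the sojourn
form in `Literature/Geometry/Lorentzian/NullInfinity.lean` (module docstring, "Why the sojourn
form"; Dafermos, CQG 22 (2005) §1). So NO maximal development of such a member satisfies the
far-completeness conclusion of the items.

The thresholds are elementary (part 1): at `r₀ = M` the exposed-edge threshold is
`(M² + a²)/(2M) = M − Mχ/2` with `χ = 1 − (a/M)²` (`edge_threshold_eq`), the exposed sub-extremal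
window `(|a|, M − Mχ/2)` is non-empty for every sub-extremal `(M, a)` (`abs_lt_edge_threshold`),
and the extremal member `M' = |a|` — the start of the naked segment — sits at mass defect
`M − |a| ∈ [Mχ/2, Mχ]` (`defect_extremal_bounds`). In every data topology that does NOT pin the
ADM mass (the companion files `KerrMassPinning*.lean` show that `H^s_δ × H^{s-1}_{δ+1}` pins it iff
`δ ≥ -1/2`; the un-pinned topologies `δ < -1/2` are the only ones in which the basins are of any
use to the crux, `AdversarialWitnesses.lean` §3) the distance from the reference to the member of
mass `M'` is `≍ K·|M − M'|`. Hence **the distance from `Kerr.data M a M` to the nearest honest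
vacuum datum none of whose developments is a far-complete sub-extremal black hole is `Θ(M·χ)`,
i.e. `Θ(κ²)` in surface gravity** — for bookkeeping reasons that have nothing to do with
red-shift, superradiance or Aretakis growth.

## Consequences (exponent bookkeeping in part 1; the two structural theorems below)

* `near_inner_false_of_gamma_lt_one`: for EVERY exponent package with `γ < 1`, every spin
  threshold `a₁ < 1`, every `M > 0` and every basin constant `c > 0`, the inner clause of
  `NearExtremalKappaCapture` is FALSE (the overspinning member of mass `M(1 − χ)` at spin
  `a = M√(1 − χ)` enters the basin `c·χ^γ` for small `χ`: `exists_chi_linear_lt_rpow`). So any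
  TRUE instance of the near-extremal hypothesis in an un-pinned topology has `γ ≥ 1`: the
  "κ-power basin" shrinks at least like `κ²`, the AKU-type basin uniform in `κ` (`γ = 0`, the
  route's model case arXiv:2603.10378 Thm 1) is not expressible by item 10606 at all, and the
  route rationale "(ii) polynomial closeness relative to `κ` suffices" means closeness `o(χ)`
  INCLUDING calibration of the mass to relative precision `o(κ²)`.
* For `γ ≥ 1` a small constant clears the threshold (`basin_le_half_defect_of_one_le`:
  `c ≤ K'M/2 ⇒ c·χ^γ ≤ K'·Mχ/2`), so the ceiling is attained inside the mass family: `γ = 1` with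
  `c(M) ≤ K(M)·M/2` is the best the typing allows.
* `bulk_inner_false_of_threshold_lt`: the inner clause of `BulkKerrCapture` at spin threshold
  `a₁ ∈ [0, 1)` is FALSE for every `ε > K(M)·M(1 − a₁²)/2` (exposed-edge member just below the
  threshold at spin `a₁M`): the bulk basin radius is at most the Lipschitz constant times half
  the extremality defect — harmless for item 10696 (`ε` is existential per `M`), but it is the
  same ceiling.
* Repairs are the planner's (advisory): fixing the packages of 10606/10696 (cycle-1 advice:
  `δ < -1/2`, `k = 2`, explicit `γ, p`) MUST take `γ ≥ 1` — with `γ < 1` and `δ < -1/2` item 10606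
  is false in print and the route would die at rank 2 for a bookkeeping reason; a near-extremal
  capture statement with a `κ`-uniform basin has to change shape (data required to contain a
  marginally outer trapped sphere enclosing the inner edge, conclusion in the CLOSED family
  `|a'| ≤ M'`, i.e. the threshold/dichotomy form of Kehle–Unger arXiv:2211.15742 /
  Angelopoulos–Kehle–Unger arXiv:2410.16234), because every certificate of "a horizon encloses
  the edge" carried by the reference datum itself degenerates like a power of `κ`.

## Hypotheses of the structural theorems (all true in print, none constructible here)

* `hmghd : choquetBruhat_geroch_exists_mghd_cauchy` — the tree's named fact (MGHD existence,
  `CauchyProblemMGHDExistence.lean`), needed because the items' conclusions are asserted for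
  every maximal development and are vacuous without one.
* `hvac : ∀ M' a r₀, Kerr.data_isVacuumConstraintSolution M' a r₀` — the tree's named fact
  (`KerrData.lean`; Kerr–Schild Kerr is Ricci-flat for every real `a`, García-Parrado–Valiente
  Kroon 2008 §5), for all parameters including overspinning ones.
* `hedge` (visible edge ⇒ no far-complete MGHD), stated inline: for `0 ≤ M'` and either
  `M' < |a|`, `0 < r₀` (no horizon) or `|a| ≤ M'`, `Kerr.rPlus M' a < r₀` (horizon below the
  edge), no maximal vacuum Cauchy development of `Kerr.data M' a r₀` satisfies the far-origin
  sojourn clause of the items (verbatim). Print: Choquet-Bruhat–Geroch 1969 + Ringström 2009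
  Thm 16.6 (the MGHD is the domain of dependence of the truncated slice in the Kerr–Schild
  spacetime), Hawking–Ellis Prop. 6.5.3 (its future Cauchy horizon is ruled by null geodesics
  from the edge), and the bounded-sojourn computation for ingoing far rays recorded in
  `NullInfinity.lean` (Dafermos CQG 22 (2005) §1).
* `hK` (Lipschitz dependence of the data distance on the mass along the family, with a
  constant `K M` uniform in the spin `|a| < M` and in `M' ∈ [0, M]`), stated inline at the
  package's `(s, δ)`. Print: TRUE iff `δ < -1/2` (`h_{M'} − h_M = 2(M' − M)·r³/(r⁴ + a²z²)·ℓ⃗ ⊗ ℓ⃗`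
  is linear in the mass with `m`-th derivatives `O(|ΔM| r^{-1-m})`, `k_{M'} − k_M` is smooth in
  the mass with `m`-th derivatives `O(|ΔM| r^{-2-m})`, everything smooth up to the edge `r = M`
  and continuous in `a` up to `|a| = M`; the weighted integrals converge iff `2δ < -1`); for
  `δ ≥ -1/2` it is FALSE (`dataWeightedSobolevEDist_kerr_eq_top_of_neg_half_le`), and there the
  theorems say nothing — those are the mass-pinned topologies.
-/

-- the problem namespace `FinalStateConjecture.FinalStateConjecture` (single-conjunct summit) trips dupNamespace
set_option linter.dupNamespace false

noncomputable section

open scoped Manifold ContDiff Topology ENNReal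
open Set Filter MeasureTheory

namespace Summit.FinalStateConjecture.FinalStateConjecture.Theorems.CaptureSuffices.Negative

open Literature.Geometry.Lorentzian

/-! ## The structural theorems (modulo the print-true hypotheses of the module docstring) -/

/-- **The near-extremal capture clause is false for every package with `γ < 1`** (at every
`M > 0`, every spin threshold `a₁ < 1`, every basin constant `c > 0` and modulus constant `C`),
granted: MGHD existence (`hmghd`, tree fact), the vacuum constraints for Kerr–Schild slice data
of all parameters (`hvac`, tree fact), "visible edge ⇒ no maximal development is far-complete"
(`hedge`, print: CBG + Ringström Thm 16.6 + Hawking–Ellis 6.5.3 + the sojourn computation of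
`NullInfinity.lean`), and Lipschitz dependence of the `(s, δ)`-distance on the mass along the
family (`hK`, print-true iff `δ < -1/2`). The negated clause is VERBATIM the body of
`NearExtremalKappaCapture` (item 10606) after its quantifier prefix
`∃ (s δ k γ p a₁), a₁ < 1 ∧ ∀ M > 0, ∃ c > 0, ∃ C`. Witness: spin `a = M√(1 − χ)` (so that
`1 − (a/M)² = χ`), the OVERSPINNING member `Kerr.data (M(1 − χ)) a M` (`M(1 − χ) < |a|`), at
distance `≤ K(M)·Mχ < c·χ^γ` for `χ` small (`exists_chi_linear_lt_rpow`). Reading: any TRUE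
instance of the near-extremal hypothesis of `CaptureSuffices` in an un-pinned data topology has
basin exponent `γ ≥ 1` — the basin shrinks at least like `χ ≍ κ²` for kinematic reasons. -/
theorem near_inner_false_of_gamma_lt_one [Kerr.Facts] [Kerr.SliceFacts]
    (hmghd : choquetBruhat_geroch_exists_mghd_cauchy)
    (hvac : ∀ M' a r₀ : ℝ, Kerr.data_isVacuumConstraintSolution M' a r₀)
    (hedge : ∀ (M' a r₀ : ℝ) (hM' : 0 ≤ M'),
      (M' < |a| ∧ 0 < r₀ ∨ |a| ≤ M' ∧ Kerr.rPlus M' a < r₀) →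
      ∀ 𝒟 : VacuumCauchyDevelopment (Kerr.data M' a r₀ hM'), 𝒟.IsMaximal →
        ¬ (∀ [𝒟.metric.HasLeviCivita], ∃ B₀ : Set (Kerr.slice a r₀), IsCompact B₀ ∧
            ∀ σ : ℝ, 0 < σ → ∃ B₁ : Set (Kerr.slice a r₀), IsCompact B₁ ∧
              ∀ q ∈ {q : Kerr.slice a r₀ | Kerr.afRadius a r₀ + 1 ≤ ‖(q : E3)‖}, q ∉ B₁ →
                ∀ (ray : ℝ → 𝒟.carrier) (dom : Set ℝ),
                  𝒟.metric.IsNormalisedNullRayFrom 𝒟.timeOrientation 𝒟.embed 𝒟.normal q ray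
                    dom →
                  ¬ BddAbove dom ∨ ENNReal.ofReal σ ≤ sojournTime ray dom
                    (𝒟.metric.causalFuture 𝒟.timeOrientation (𝒟.embed '' B₀))))
    {s : ℕ} {δ : ℝ} (K : ℝ → ℝ)
    (hK : ∀ (M : ℝ) (hM : 0 < M) (a : ℝ), |a| < M → ∀ (M' : ℝ) (hM' : 0 ≤ M'), M' ≤ M →
      InitialDataSet.dataWeightedSobolevEDist s δ (Kerr.data M' a M hM') (Kerr.data M a M hM.le) ≤
        ENNReal.ofReal (K M * (M - M')))
    {k : ℕ} {γ p a₁ : ℝ} (ha₁ : a₁ < 1) (hγ : γ < 1) {M : ℝ} (hM : 0 < M) {c : ℝ} (hc : 0 < c)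
    (C : ℝ) :
    ¬ (∀ a : ℝ, a₁ * M ≤ |a| → Kerr.IsSubextremal M a →
        ∀ (D : InitialDataSet 𝓘(ℝ, E3) (Kerr.slice a M)) [D.metric.HasLeviCivita],
          D.IsVacuumConstraintSolution →
          InitialDataSet.dataWeightedSobolevEDist s δ D (Kerr.data M a M hM.le) <
            ENNReal.ofReal (c * (1 - (a / M) ^ 2) ^ γ) →
          ∀ 𝒟 : VacuumCauchyDevelopment D, 𝒟.IsMaximal →
            ∃ (M' a' : ℝ) (𝒟oc : Set 𝒟.carrier), Kerr.IsSubextremal M' a' ∧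
              (∀ [𝒟.metric.HasLeviCivita], ∃ B₀ : Set (Kerr.slice a M), IsCompact B₀ ∧
                ∀ σ : ℝ, 0 < σ → ∃ B₁ : Set (Kerr.slice a M), IsCompact B₁ ∧
                  ∀ q ∈ {q : Kerr.slice a M | Kerr.afRadius a M + 1 ≤ ‖(q : E3)‖}, q ∉ B₁ →
                    ∀ (ray : ℝ → 𝒟.carrier) (dom : Set ℝ),
                      𝒟.metric.IsNormalisedNullRayFrom 𝒟.timeOrientation 𝒟.embed 𝒟.normal q ray
                        dom →
                      ¬ BddAbove dom ∨ ENNReal.ofReal σ ≤ sojournTime ray dom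
                        (𝒟.metric.causalFuture 𝒟.timeOrientation (𝒟.embed '' B₀))) ∧
              𝒟.toSpacetime.ConvergesToKerr 𝒟oc M' a' k ∧
              |M' - M| + |a' - a| ≤ C * (1 - (a / M) ^ 2) ^ (-p) *
                √(InitialDataSet.dataWeightedSobolevEDist s δ D (Kerr.data M a M hM.le)).toReal) := by
  intro H
  set K₁ : ℝ := max (K M) 1 with hK₁
  have hK₁0 : 0 < K₁ := lt_of_lt_of_le one_pos (le_max_right _ _)
  have hm0 : 0 ≤ max a₁ 0 := le_max_right _ _
  have hm1 : max a₁ 0 < 1 := max_lt ha₁ one_pos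
  have hχ₀ : 0 < 1 - (max a₁ 0) ^ 2 := by nlinarith
  obtain ⟨χ, hχ0, hχlt, hχ1, hineq⟩ := exists_chi_linear_lt_rpow hγ (mul_pos hK₁0 hM) hc hχ₀
  have hχlt1 : χ < 1 := by nlinarith [sq_nonneg (max a₁ 0)]
  set a : ℝ := M * √(1 - χ) with ha_def
  set M' : ℝ := M * (1 - χ) with hM'_def
  have hsq : √(1 - χ) ^ 2 = 1 - χ := Real.sq_sqrt (by linarith)
  have hs0 : 0 ≤ √(1 - χ) := Real.sqrt_nonneg _
  have hs1 : √(1 - χ) < 1 := by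
    rw [Real.sqrt_lt' one_pos]
    linarith
  have hslt : 1 - χ < √(1 - χ) := by
    rw [Real.lt_sqrt (by linarith)]
    nlinarith
  have hsm : max a₁ 0 ≤ √(1 - χ) := by
    rw [Real.le_sqrt hm0 (by linarith)]
    linarith
  have ha_abs : |a| = M * √(1 - χ) := by
    rw [ha_def, abs_mul, abs_of_pos hM, abs_of_nonneg hs0]
  have hM'0 : 0 ≤ M' := mul_nonneg hM.le (by linarith)
  have hM'le : M' ≤ M := by
    rw [hM'_def]
    nlinarith
  have hsub : Kerr.IsSubextremal M a := by
    show |a| < M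
    rw [ha_abs]
    exact mul_lt_of_lt_one_right hM hs1
  have harange : a₁ * M ≤ |a| := by
    rw [ha_abs]
    calc a₁ * M ≤ max a₁ 0 * M := mul_le_mul_of_nonneg_right (le_max_left _ _) hM.le
      _ ≤ √(1 - χ) * M := mul_le_mul_of_nonneg_right hsm hM.le
      _ = M * √(1 - χ) := mul_comm _ _
  have hnak : M' < |a| := by
    rw [ha_abs, hM'_def]
    exact mul_lt_mul_of_pos_left hslt hM
  have hdiv : a / M = √(1 - χ) := by
    rw [ha_def]
    field_simp
  have hchi : 1 - (a / M) ^ 2 = χ := by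
    rw [hdiv, hsq]
    ring
  set D := Kerr.data M' a M hM'0 with hD
  haveI : D.metric.HasLeviCivita := D.metric.hasLeviCivita
  have hvacD : D.IsVacuumConstraintSolution := hvac M' a M hM'0
  have hdist : InitialDataSet.dataWeightedSobolevEDist s δ D (Kerr.data M a M hM.le) <
      ENNReal.ofReal (c * (1 - (a / M) ^ 2) ^ γ) := by
    refine lt_of_le_of_lt (hK M hM a hsub M' hM'0 hM'le) ?_
    rw [hchi, ENNReal.ofReal_lt_ofReal_iff (mul_pos hc (Real.rpow_pos_of_pos hχ0 γ))]
    have hMM' : M - M' = M * χ := by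
      rw [hM'_def]
      ring
    rw [hMM']
    calc K M * (M * χ) ≤ K₁ * (M * χ) :=
          mul_le_mul_of_nonneg_right (le_max_left _ _) (by positivity)
      _ = K₁ * M * χ := by ring
      _ < c * χ ^ γ := hineq
  obtain ⟨𝒟, h𝒟⟩ := hmghd (Kerr.slice a M) D hvacD
  obtain ⟨M'', a'', 𝒟oc, -, hfar, -, -⟩ := H a harange hsub D hvacD hdist 𝒟 h𝒟
  exact hedge M' a M hM'0 (Or.inl ⟨hnak, hM⟩) 𝒟 h𝒟 hfar

/-- **The bulk capture clause fails for every basin radius beyond half the extremality defect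
times the Lipschitz constant.** Under the same print-true hypotheses, for `0 ≤ a₁ < 1`, `M > 0`
with `0 < K M`, and every `ε > K(M)·M(1 − a₁²)/2`, the inner clause of `BulkKerrCapture`
(item 10696; VERBATIM its body after `∀ a₁ < 1, ∃ (s δ k), ∀ M > 0, ∃ ε > 0, ∃ C`) is FALSE.
Witness: spin `a = a₁M` and the exposed-edge SUB-extremal member of mass
`M' = (M² + a²)/(2M) − τ = M − M(1 − a₁²)/2 − τ` (`0 < τ` small; `|a| < M'`, `rPlus M' a < M` by
`rPlus_lt_iff`), at distance `≤ K(M)·(M(1 − a₁²)/2 + τ) < ε`. Reading: the bulk basin of item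
10696 is at most `K(M)·M(1 − a₁²)/2` — harmless for the item (`ε` is existential), but the
same kinematic ceiling as for the near-extremal item. -/
theorem bulk_inner_false_of_threshold_lt [Kerr.Facts] [Kerr.SliceFacts]
    (hmghd : choquetBruhat_geroch_exists_mghd_cauchy)
    (hvac : ∀ M' a r₀ : ℝ, Kerr.data_isVacuumConstraintSolution M' a r₀)
    (hedge : ∀ (M' a r₀ : ℝ) (hM' : 0 ≤ M'),
      (M' < |a| ∧ 0 < r₀ ∨ |a| ≤ M' ∧ Kerr.rPlus M' a < r₀) →
      ∀ 𝒟 : VacuumCauchyDevelopment (Kerr.data M' a r₀ hM'), 𝒟.IsMaximal →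
        ¬ (∀ [𝒟.metric.HasLeviCivita], ∃ B₀ : Set (Kerr.slice a r₀), IsCompact B₀ ∧
            ∀ σ : ℝ, 0 < σ → ∃ B₁ : Set (Kerr.slice a r₀), IsCompact B₁ ∧
              ∀ q ∈ {q : Kerr.slice a r₀ | Kerr.afRadius a r₀ + 1 ≤ ‖(q : E3)‖}, q ∉ B₁ →
                ∀ (ray : ℝ → 𝒟.carrier) (dom : Set ℝ),
                  𝒟.metric.IsNormalisedNullRayFrom 𝒟.timeOrientation 𝒟.embed 𝒟.normal q ray
                    dom →
                  ¬ BddAbove dom ∨ ENNReal.ofReal σ ≤ sojournTime ray dom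
                    (𝒟.metric.causalFuture 𝒟.timeOrientation (𝒟.embed '' B₀))))
    {s : ℕ} {δ : ℝ} (K : ℝ → ℝ)
    (hK : ∀ (M : ℝ) (hM : 0 < M) (a : ℝ), |a| < M → ∀ (M' : ℝ) (hM' : 0 ≤ M'), M' ≤ M →
      InitialDataSet.dataWeightedSobolevEDist s δ (Kerr.data M' a M hM') (Kerr.data M a M hM.le) ≤
        ENNReal.ofReal (K M * (M - M')))
    {k : ℕ} {a₁ : ℝ} (ha₁0 : 0 ≤ a₁) (ha₁ : a₁ < 1) {M : ℝ} (hM : 0 < M) (hKM : 0 < K M)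
    {ε : ℝ} (C : ℝ) (hε : K M * (M * (1 - a₁ ^ 2) / 2) < ε) :
    ¬ (∀ a : ℝ, |a| ≤ a₁ * M →
        ∀ (D : InitialDataSet 𝓘(ℝ, E3) (Kerr.slice a M)) [D.metric.HasLeviCivita],
          D.IsVacuumConstraintSolution →
          InitialDataSet.dataWeightedSobolevEDist s δ D (Kerr.data M a M hM.le) <
            ENNReal.ofReal ε →
          ∀ 𝒟 : VacuumCauchyDevelopment D, 𝒟.IsMaximal →
            ∃ (M' a' : ℝ) (𝒟oc : Set 𝒟.carrier), Kerr.IsSubextremal M' a' ∧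
              (∀ [𝒟.metric.HasLeviCivita], ∃ B₀ : Set (Kerr.slice a M), IsCompact B₀ ∧
                ∀ σ : ℝ, 0 < σ → ∃ B₁ : Set (Kerr.slice a M), IsCompact B₁ ∧
                  ∀ q ∈ {q : Kerr.slice a M | Kerr.afRadius a M + 1 ≤ ‖(q : E3)‖}, q ∉ B₁ →
                    ∀ (ray : ℝ → 𝒟.carrier) (dom : Set ℝ),
                      𝒟.metric.IsNormalisedNullRayFrom 𝒟.timeOrientation 𝒟.embed 𝒟.normal q ray
                        dom →
                      ¬ BddAbove dom ∨ ENNReal.ofReal σ ≤ sojournTime ray dom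
                        (𝒟.metric.causalFuture 𝒟.timeOrientation (𝒟.embed '' B₀))) ∧
              𝒟.toSpacetime.ConvergesToKerr 𝒟oc M' a' k ∧
              |M' - M| + |a' - a| ≤
                C * √(InitialDataSet.dataWeightedSobolevEDist s δ D (Kerr.data M a M hM.le)).toReal) := by
  intro H
  set a : ℝ := a₁ * M with ha_def
  have ha0 : 0 ≤ a := mul_nonneg ha₁0 hM.le
  have ha_abs : |a| = a₁ * M := abs_of_nonneg ha0
  have haM : |a| < M := by
    rw [ha_abs]
    exact mul_lt_of_lt_one_left hM ha₁
  set d : ℝ := M * (1 - a₁ ^ 2) / 2 with hd_def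
  have ha1sq : a₁ ^ 2 < 1 := by nlinarith
  have hd0 : 0 < d := by
    rw [hd_def]
    have : 0 < 1 - a₁ ^ 2 := by linarith
    positivity
  have hgap : 0 < M * (1 - a₁) ^ 2 / 4 := by
    have : 0 < (1 - a₁) ^ 2 := by nlinarith
    positivity
  set τ : ℝ := min ((ε - K M * d) / (2 * K M)) (M * (1 - a₁) ^ 2 / 4) with hτ_def
  have hτ0 : 0 < τ := lt_min (div_pos (by linarith) (by positivity)) hgap
  have hτ1 : τ ≤ (ε - K M * d) / (2 * K M) := min_le_left _ _
  have hτ2 : τ ≤ M * (1 - a₁) ^ 2 / 4 := min_le_right _ _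
  set M' : ℝ := (M ^ 2 + a ^ 2) / (2 * M) - τ with hM'_def
  have hthr : (M ^ 2 + a ^ 2) / (2 * M) = M - d := by
    rw [hd_def, ha_def]
    field_simp
    ring
  have hM'eq : M' = M - d - τ := by rw [hM'_def, hthr]
  have haM' : |a| ≤ M' := by
    rw [ha_abs, hM'eq, hd_def]
    nlinarith
  have hM'0 : 0 ≤ M' := le_trans (abs_nonneg a) haM'
  have hM'le : M' ≤ M := by
    rw [hM'eq]
    linarith
  have hrplus : Kerr.rPlus M' a < M := by
    rw [rPlus_lt_iff haM, hM'_def]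
    linarith
  set D := Kerr.data M' a M hM'0 with hD
  haveI : D.metric.HasLeviCivita := D.metric.hasLeviCivita
  have hvacD : D.IsVacuumConstraintSolution := hvac M' a M hM'0
  have hdist : InitialDataSet.dataWeightedSobolevEDist s δ D (Kerr.data M a M hM.le) <
      ENNReal.ofReal ε := by
    refine lt_of_le_of_lt (hK M hM a haM M' hM'0 hM'le) ?_
    rw [ENNReal.ofReal_lt_ofReal_iff (lt_trans (mul_pos hKM hd0) hε)]
    have hMM' : M - M' = d + τ := by
      rw [hM'eq]
      ring
    rw [hMM']
    have h1 : K M * τ ≤ (ε - K M * d) / 2 := by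
      calc K M * τ ≤ K M * ((ε - K M * d) / (2 * K M)) := mul_le_mul_of_nonneg_left hτ1 hKM.le
        _ = (ε - K M * d) / 2 := by field_simp
    nlinarith
  obtain ⟨𝒟, h𝒟⟩ := hmghd (Kerr.slice a M) D hvacD
  obtain ⟨M'', a'', 𝒟oc, -, hfar, -, -⟩ := H a (le_of_eq ha_abs) D hvacD hdist 𝒟 h𝒟
  exact hedge M' a M hM'0 (Or.inr ⟨haM', hrplus⟩) 𝒟 h𝒟 hfar

end Summit.FinalStateConjecture.FinalStateConjecture.Theorems.CaptureSuffices.Negative
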